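import Summits.HodgeConjecture.HodgeConjecture.Theorems.Ring2WeilCoveragePfaffianFormLattice
import HarnessLib

/-!
# Weil-type family coverage — the placement law for frames FREE OVER AN ORDER, and the cyclotomic rows

research route conditional on HC_CM; not a corollary; Q11.4-sentence-2 already refuted in dim ≥ 3.

Ring 2, WEIL-TYPE FAMILY-COVERAGE CENSUS (`HOME/WEIL-FAMILY-COVERAGE.md` `## b04`, block b04.7 «CYCLIC-PRYM
PLACEMENT FOR EVERY m», split-special-fibre column, owner ring2-b04). Gen 42's
`Ring2WeilCoveragePfaffianFormLattice` proved the placement law in lattice form on the tree's complex-torus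
carriers: for a `K`-frame of lattice vectors with integer coordinate matrix `P` in a polarised complex torus
of type `(d₁, …, d_g)`, **`(-1)ⁿ · det Ψ = |det P| · d₁⋯d_g`** (`neg_one_pow_mul_det_eq_natAbs_of_frame`),
hence `[det Ψ]` is the split class iff `|det P| · d₁⋯d_g ∈ Nm(K_dˣ)`.

This file adds refinement **(R1)** of b04.5 — «if the lattice is FREE over an order `O' = ℤ[ω] ∋ x` then the
index `[Λ : Λ₀]` of the `ℤ[x]`-span of an `O'`-basis frame is `[O' : ℤ[x]]^{2n}`, a SQUARE, so the component
IS the class of the polarisation TYPE `d₁⋯d_g`» — and the arithmetic of the classes `[2^α 3^β]`, `[3^α 5^β]`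
modulo `Nm(ℚ(i)ˣ)` / `Nm(ℚ(√-3)ˣ)` that decide on which census row a cyclic-Prym piece `B_m ⊂ J(C̃)`
(`m ∈ {3, 4, 6, 12, 18, 36, 15, 30, 45, 90, …}`: `Λ_B` free over the principal order `ℤ[ζ_m] ⊇ O_K`, every
`dᵢ ∣ m`) lies:

* §1 `det_fromBlocks_one_smul`, `natAbs_det_mul_eq_of_natAbs_det_eq_one`, `natAbs_det_orderFrame`,
  `natAbs_det_orderFrame_eq_sq` — the coordinate matrix of the `K`-frame `{eᵢ, x·eᵢ}` (`x = u + v·ω`) in a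
  `ℤ`-basis `{eᵢ, ω·eᵢ}` adapted to a free `ℤ[ω]`-structure is `U · [[1, u·1], [0, v·1]]` with `U` unimodular,
  of determinant `± v^{2n}`: **the index is the perfect square `(|v|ⁿ)²`**;
* §2 `pow_two_mul_mem_normUnitsSubgroup`, `sq_mul_mem_normUnitsSubgroup_iff` — squares are norms, so a square
  factor of `a` does not move the class;
* §3 **`mk_det_eq_splitDiscriminantClass_iff_prod_type_mem_of_index_sq`** — (R1) ON THE CARRIERS: in the
  setting of the gen-42 law, if `|det P| = w²` then `[det Ψ] = splitDiscriminantClass n d ↔ d₁⋯d_g ∈ Nm(K_dˣ)`: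
  **the component of a special fibre with an order-free lattice is the class of its polarisation type**;
* §4 `SqrtNeg1.two_pow_mul_three_pow_mem_iff` (`2^α 3^β ∈ Nm(ℚ(i)ˣ) ↔ β` even), `SqrtNeg3.two_pow_mul_three_pow_mem_iff`
  (`↔ α` even), `SqrtNeg3.three_pow_mul_five_pow_mem_iff` (`↔ β` even), `SqrtNeg2.two_pow_mul_three_pow_mem`
  (always) — the classes a `ℤ/m`-piece can have for `m ∣ 36` resp. `m ∣ 90`, `8 ∣ m ∣ 72`;
* §5 the census sentences: `sqrtNeg1_mk_det_eq_split_iff_even_of_type_two_three` — a `ℚ(i)`-Weil piece with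
  order-free lattice and type `∏dᵢ = 2^α 3^β` (every `ℤ/12`-, `ℤ/36`-Prym piece) lies on the SPLIT row iff
  `β = v₃(d₁⋯d_g)` is even, on row `(n, ℚ(i), [(-1)ⁿ·3])` (pub-hsemireg R3 at `n = 3`) iff `β` is odd;
  `sqrtNeg3_mk_det_eq_split_iff_even_of_type_two_three` — a `ℚ(√-3)`-piece of type `2^α 3^β` (`ℤ/6`, `ℤ/12`,
  `ℤ/18`, `ℤ/36`) is split iff `α = v₂` is even (row R1 = `[(-1)ⁿ·2]` iff odd: ring2-b06 b06.5 (B)(ii) /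
  pub-hsemireg t-3 PARITY LEMMA, now for every such `m`); `sqrtNeg3_mk_det_eq_split_iff_even_of_type_three_five`
  — type `3^α 5^β` (`ℤ/15`, `ℤ/45`): split iff `β = v₅` even, row `[(-1)ⁿ·5]` (`T = {3,5}`: R2 at `n = 3`,
  W8.3.5 at `n = 4`) iff odd.

What stays TEXT (T)/(S) in the census block and is NOT claimed here: that `H₁(B_m, ℤ)` of an actual cyclic
Prym is free over `ℤ[ζ_m]` (PID for the listed `m`) hence over `O_K`, that `dᵢ ∣ m` ([BL 5.3.4], kernel
`smul_mem_lattice_of_dual`), and the closed form `v_p(d₁⋯d_g) = Σ_{t ∣ s} μ(s/t) g(C̃/σ^{p^{a-1}t})`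
([LR22 Prop. 3.2.8, 3.2.1 (a)]); those are b04.7 (S), machine-checked by kit j170741. No `def`, no named fact,
no `sorry`; nothing here is a statement about Hodge classes; `HC_CM` is used nowhere.

References: [cite: vanGeemen1994HodgeAV, Lemma 5.2, 5.4 and (5.4.1)]; [cite: Lange2023AbelianVarietiesComplex,
§1.5.1, §1.7.1]; Birkenhake–Lange §3.1, 5.3.4; Lange–Rodríguez LNM 2310 Prop. 3.2.1 (a), 3.2.8.
-/

set_option linter.dupNamespace false

open Matrix
open Literature.AlgebraicGeometry.Motives (normUnitsSubgroup)
open Literature.AlgebraicGeometry.VanGeemen1994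
open Literature.Geometry.Kaehler.ComplexTorus
open Summit.HodgeConjecture.HodgeConjecture.Ring2.Hypotheses
open Summit.HodgeConjecture.HodgeConjecture.Ring2.AbelianAll (weilStdGramMatrix)

namespace Summit.HodgeConjecture.HodgeConjecture.Ring2.WeilCoverage

/-! ### §1 Order frames: the index of the `ℤ[x]`-span of an `O'`-basis is a `2n`-th power -/

section OrderFrame

variable {R : Type*} [CommRing R] {k : Type*} [Fintype k] [DecidableEq k]

/-- `det [[1, u·1], [0, v·1]] = v^{|k|}`: the coordinate matrix of `{eᵢ, (u + vω)·eᵢ}` in the basis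
`{eᵢ, ω·eᵢ}` (block upper triangular).
research route conditional on HC_CM; not a corollary; Q11.4-sentence-2 already refuted in dim ≥ 3. [folklore] -/
theorem det_fromBlocks_one_smul (u v : R) :
    (Matrix.fromBlocks (1 : Matrix k k R) (u • (1 : Matrix k k R)) 0 (v • (1 : Matrix k k R))).det =
      v ^ Fintype.card k := by
  rw [Matrix.det_fromBlocks_zero₂₁, Matrix.det_one, one_mul, Matrix.det_smul, Matrix.det_one, mul_one]

/-- A unimodular change of `ℤ`-basis does not change `|det|`.
research route conditional on HC_CM; not a corollary; Q11.4-sentence-2 already refuted in dim ≥ 3. [folklore] -/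
theorem natAbs_det_mul_eq_of_natAbs_det_eq_one {ι : Type*} [Fintype ι] [DecidableEq ι]
    (U B : Matrix ι ι ℤ) (hU : U.det.natAbs = 1) : (U * B).det.natAbs = B.det.natAbs := by
  rw [Matrix.det_mul, Int.natAbs_mul, hU, one_mul]

/-- **Index of an order frame.** If the lattice `ℤ^{k ⊕ k}` carries a `ℤ`-basis `{eᵢ, ω·eᵢ}` (columns of the
unimodular `U`) adapted to a FREE `ℤ[ω]`-module structure with basis `(eᵢ)_{i ∈ k}`, and `x = u + v·ω`, then the
`K`-frame `{eᵢ, x·eᵢ}` has integer coordinate matrix `U · [[1, u·1], [0, v·1]]`, whose `|det|` — the index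
`[Λ : Σᵢ ℤ[x]·eᵢ]` by `index_span_frame_eq_natAbs_det` — is `|v|^{|k|} = [ℤ[ω] : ℤ[x]]^{|k|}`.
research route conditional on HC_CM; not a corollary; Q11.4-sentence-2 already refuted in dim ≥ 3.
[cite: Lange2023AbelianVarietiesComplex, §1.1.2 proof of Prop. 1.1.13 (c) (index = `|det|`)] -/
theorem natAbs_det_orderFrame (U : Matrix (k ⊕ k) (k ⊕ k) ℤ) (hU : U.det.natAbs = 1) (u v : ℤ) :
    (U * Matrix.fromBlocks (1 : Matrix k k ℤ) (u • (1 : Matrix k k ℤ)) 0 (v • (1 : Matrix k k ℤ))).det.natAbs =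
      v.natAbs ^ Fintype.card k := by
  rw [natAbs_det_mul_eq_of_natAbs_det_eq_one _ _ hU, det_fromBlocks_one_smul, Int.natAbs_pow]

/-- **The index of an order frame of EVEN rank `|k| = 2n` is a perfect square `(|v|ⁿ)²`** — refinement (R1)
of the placement law: for a lattice free over an order containing `x`, `[Λ : Λ₀]` is a square, so modulo
`Nm(K_dˣ)` (which contains all squares) the component is the class of `d₁⋯d_g` alone.
research route conditional on HC_CM; not a corollary; Q11.4-sentence-2 already refuted in dim ≥ 3. [folklore] -/
theorem natAbs_det_orderFrame_eq_sq {n : ℕ} (hk : Fintype.card k = 2 * n) (U : Matrix (k ⊕ k) (k ⊕ k) ℤ)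
    (hU : U.det.natAbs = 1) (u v : ℤ) :
    (U * Matrix.fromBlocks (1 : Matrix k k ℤ) (u • (1 : Matrix k k ℤ)) 0 (v • (1 : Matrix k k ℤ))).det.natAbs =
      (v.natAbs ^ n) ^ 2 := by
  rw [natAbs_det_orderFrame U hU u v, hk, pow_mul, ← pow_mul, ← pow_mul, mul_comm]

end OrderFrame

/-! ### §2 Square factors do not move the class -/

/-- `w^{2n} ∈ Nm(K_dˣ)` (`= (wⁿ)² + d·0²`).
research route conditional on HC_CM; not a corollary; Q11.4-sentence-2 already refuted in dim ≥ 3. [folklore] -/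
theorem pow_two_mul_mem_normUnitsSubgroup {d : ℕ} {w : ℚ} (hw : w ≠ 0) (n : ℕ) :
    Units.mk0 (w ^ (2 * n)) (pow_ne_zero _ hw) ∈ normUnitsSubgroup ℚ (weilField d) := by
  have h : Units.mk0 (w ^ (2 * n)) (pow_ne_zero _ hw) =
      Units.mk0 ((w ^ n) ^ 2) (pow_ne_zero 2 (pow_ne_zero n hw)) :=
    Units.ext (by rw [Units.val_mk0, Units.val_mk0, ← pow_mul, mul_comm])
  rw [h]
  exact sq_mem_normUnitsSubgroup (pow_ne_zero n hw)

/-- **`w²·t ∈ Nm(K_dˣ) ↔ t ∈ Nm(K_dˣ)`** (`w, t ≠ 0`): a square factor — e.g. the index of an order frame —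
does not change the norm class.
research route conditional on HC_CM; not a corollary; Q11.4-sentence-2 already refuted in dim ≥ 3. [folklore] -/
theorem sq_mul_mem_normUnitsSubgroup_iff {d : ℕ} {w t : ℚ} (hw : w ≠ 0) (ht : t ≠ 0) :
    Units.mk0 (w ^ 2 * t) (mul_ne_zero (pow_ne_zero 2 hw) ht) ∈ normUnitsSubgroup ℚ (weilField d) ↔
      Units.mk0 t ht ∈ normUnitsSubgroup ℚ (weilField d) := by
  rw [← mk0_mul_mk0 (pow_ne_zero 2 hw) ht]
  exact Subgroup.mul_mem_cancel_left _ (sq_mem_normUnitsSubgroup hw)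

/-! ### §3 (R1) on the carriers: order-free lattice ⟹ the component is the class of the TYPE -/

section Weil

variable {ι : Type*} {E : Type*} [NormedAddCommGroup E] [NormedSpace ℂ E]
  {Φ : (ι → ℝ) ≃L[ℝ] E} {ω : E [⋀^Fin 2]→L[ℝ] ℝ} {g : ℕ} {dtyp : Fin g → ℕ}
  {n d : ℕ} {a b : Matrix (Fin (2 * n)) (Fin (2 * n)) ℚ} {q : ℚ}

/-- Cast bookkeeping: `|(det P) · ∏ dᵢ| = |det P| · ∏ dᵢ` in `ℚ` (the `dᵢ` are natural numbers).
research route conditional on HC_CM; not a corollary; Q11.4-sentence-2 already refuted in dim ≥ 3. [folklore] -/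
theorem natAbs_det_mul_prod_cast (P : Matrix (Fin (4 * n)) (Fin (4 * n)) ℤ) :
    (((P.det * ∏ i, (dtyp i : ℤ)).natAbs : ℕ) : ℚ) = (P.det.natAbs : ℚ) * ∏ i, (dtyp i : ℚ) := by
  rw [Int.natAbs_mul, Nat.cast_mul]
  congr 1
  rw [← Nat.cast_prod, Int.natAbs_natCast, Nat.cast_prod]

/-- **(R1) THE COMPONENT OF AN ORDER-FREE SPECIAL FIBRE IS THE CLASS OF ITS POLARISATION TYPE.** In the setting
of the lattice placement law (`neg_one_pow_mul_det_eq_natAbs_of_frame`: a polarised complex torus of type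
`(d₁,…,d_g)`, a `K`-frame with integer coordinate matrix `P`, Hermitian Gram data `Ψ = a + b√-d` with
`det Ψ = q` of Weil sign), if the index `|det P| = [ℤ^ι : Σⱼ ℤyⱼ]` is a perfect square `w²` — as it is for the
`ℤ[x]`-span of a basis of a lattice FREE over an order `O' ∋ x` (`natAbs_det_orderFrame_eq_sq`) — then
**`[det Ψ] = splitDiscriminantClass n d ↔ d₁⋯d_g ∈ Nm(K_dˣ)`**.
research route conditional on HC_CM; not a corollary; Q11.4-sentence-2 already refuted in dim ≥ 3.
[cite: vanGeemen1994HodgeAV, 5.4 and (5.4.1)] -/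
theorem mk_det_eq_splitDiscriminantClass_iff_prod_type_mem_of_index_sq (hd : IsPolarizationType Φ ω dtyp)
    (hdpos : 0 < d) (e : Fin (4 * n) ≃ ι) (P : Matrix (Fin (4 * n)) (Fin (4 * n)) ℤ)
    (hF : (Matrix.of fun j j' =>
        ω ![Φ (intVec fun i => P (e.symm i) j), Φ (intVec fun i => P (e.symm i) j')]) =
      (weilStdGramMatrix n d a b).map (Rat.cast : ℚ → ℝ))
    (ha : a.IsSymm) (hb : bᵀ = -b) (hq : (weilGramMatrix d a b).det = algebraMap ℚ (weilField d) q)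
    (hsign : 0 < (-1 : ℚ) ^ n * q) (hq0 : q ≠ 0) {w : ℕ} (hidx : P.det.natAbs = w ^ 2)
    (hprod : (∏ i, (dtyp i : ℚ)) ≠ 0) :
    (QuotientGroup.mk (Units.mk0 q hq0) : weilNormResidueGroup d) = splitDiscriminantClass n d ↔
      Units.mk0 (∏ i, (dtyp i : ℚ)) hprod ∈ normUnitsSubgroup ℚ (weilField d) := by
  have hlaw := neg_one_pow_mul_det_eq_natAbs_of_frame hd hdpos e P hF ha hb hq hsign
  have hc0 : (((P.det * ∏ i, (dtyp i : ℤ)).natAbs : ℕ) : ℚ) ≠ 0 := by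
    rw [← hlaw]
    exact ne_of_gt hsign
  have hcast : (((P.det * ∏ i, (dtyp i : ℤ)).natAbs : ℕ) : ℚ) = ((w : ℚ)) ^ 2 * ∏ i, (dtyp i : ℚ) := by
    rw [natAbs_det_mul_prod_cast, hidx, Nat.cast_pow]
  have hw : (w : ℚ) ≠ 0 := by
    intro hw0
    apply hc0
    rw [hcast, hw0, zero_pow two_ne_zero, zero_mul]
  rw [mk_det_eq_splitDiscriminantClass_iff_of_frame hd hdpos e P hF ha hb hq hsign hq0 hc0]
  have hu : Units.mk0 (((P.det * ∏ i, (dtyp i : ℤ)).natAbs : ℕ) : ℚ) hc0 =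
      Units.mk0 (((w : ℚ)) ^ 2 * ∏ i, (dtyp i : ℚ)) (mul_ne_zero (pow_ne_zero 2 hw) hprod) :=
    Units.ext hcast
  rw [hu, sq_mul_mem_normUnitsSubgroup_iff hw hprod]

end Weil

/-! ### §4 The classes of `2^α 3^β` and `3^α 5^β` — the types a `ℤ/m`-piece can have -/

/-- Powers of a norm are norms (bookkeeping: `Units.mk0 (c^α) = (Units.mk0 c)^α`).
research route conditional on HC_CM; not a corollary; Q11.4-sentence-2 already refuted in dim ≥ 3. [folklore] -/
theorem pow_mem_normUnitsSubgroup {d : ℕ} {c : ℚ} (hc : c ≠ 0)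
    (h : Units.mk0 c hc ∈ normUnitsSubgroup ℚ (weilField d)) (α : ℕ) :
    Units.mk0 (c ^ α) (pow_ne_zero α hc) ∈ normUnitsSubgroup ℚ (weilField d) := by
  have e : Units.mk0 (c ^ α) (pow_ne_zero α hc) = (Units.mk0 c hc) ^ α :=
    Units.ext (by rw [Units.val_mk0, Units.val_pow_eq_pow_val, Units.val_mk0])
  rw [e]
  exact Subgroup.pow_mem _ h α

/-- **Odd powers of a non-norm are non-norms, even powers are norms**: `c^β ∈ Nm(K_dˣ) ↔ β` even, for
`c ∉ Nm(K_dˣ)`.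
research route conditional on HC_CM; not a corollary; Q11.4-sentence-2 already refuted in dim ≥ 3. [folklore] -/
theorem pow_mem_normUnitsSubgroup_iff_even {d : ℕ} {c : ℚ} (hc : c ≠ 0)
    (h : Units.mk0 c hc ∉ normUnitsSubgroup ℚ (weilField d)) (β : ℕ) :
    Units.mk0 (c ^ β) (pow_ne_zero β hc) ∈ normUnitsSubgroup ℚ (weilField d) ↔ Even β := by
  constructor
  · intro hmem
    by_contra hodd
    rw [Nat.not_even_iff_odd] at hodd
    obtain ⟨j, rfl⟩ := hodd
    have e : Units.mk0 (c ^ (2 * j + 1)) (pow_ne_zero _ hc) =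
        Units.mk0 ((c ^ j) ^ 2) (pow_ne_zero 2 (pow_ne_zero j hc)) * Units.mk0 c hc :=
      Units.ext (by
        rw [Units.val_mul, Units.val_mk0, Units.val_mk0, Units.val_mk0, pow_succ, ← pow_mul, mul_comm j 2])
    rw [e] at hmem
    exact mul_not_mem_normUnitsSubgroup (sq_mem_normUnitsSubgroup (pow_ne_zero j hc)) h hmem
  · rintro ⟨j, rfl⟩
    have e : Units.mk0 (c ^ (j + j)) (pow_ne_zero _ hc) =
        Units.mk0 ((c ^ j) ^ 2) (pow_ne_zero 2 (pow_ne_zero j hc)) :=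
      Units.ext (by rw [Units.val_mk0, Units.val_mk0, sq, pow_add])
    rw [e]
    exact sq_mem_normUnitsSubgroup (pow_ne_zero j hc)

/-- **`u·v ∈ Nm ↔ v ∈ Nm` for `u ∈ Nm`**, at the level of `Units.mk0` of a product.
research route conditional on HC_CM; not a corollary; Q11.4-sentence-2 already refuted in dim ≥ 3. [folklore] -/
theorem mul_mem_normUnitsSubgroup_iff_of_mem {d : ℕ} {s t : ℚ} (hs : s ≠ 0) (ht : t ≠ 0)
    (h : Units.mk0 s hs ∈ normUnitsSubgroup ℚ (weilField d)) :
    Units.mk0 (s * t) (mul_ne_zero hs ht) ∈ normUnitsSubgroup ℚ (weilField d) ↔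
      Units.mk0 t ht ∈ normUnitsSubgroup ℚ (weilField d) := by
  rw [← mk0_mul_mk0 hs ht]
  exact Subgroup.mul_mem_cancel_left _ h

namespace SqrtNeg1

/-- `K = ℚ(i)`: **`2^α · 3^β ∈ Nm(ℚ(i)ˣ) ↔ β` even** (`2 = 1² + 1²` is a norm, `3 ∉ Nm(ℚ(i)ˣ)` — inert). These are
the possible values of `[Λ:Λ₀]·d₁⋯d_g` for a `ℤ/m`-Prym piece with `4 ∣ m ∣ 36` (every `dᵢ ∣ m`), so such a piece
lies on the split `ℚ(i)`-row iff `v₃(d₁⋯d_g)` is even and on the row `[(-1)ⁿ·3]` (`T = {2, 3}`; R3 at `n = 3`) iff odd.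
research route conditional on HC_CM; not a corollary; Q11.4-sentence-2 already refuted in dim ≥ 3. [cite: vanGeemen1994HodgeAV, (5.4.1)] -/
theorem two_pow_mul_three_pow_mem_iff (α β : ℕ) :
    Units.mk0 ((2 : ℚ) ^ α * 3 ^ β) (mul_ne_zero (pow_ne_zero α two_ne_zero) (pow_ne_zero β three_ne_zero)) ∈
        normUnitsSubgroup ℚ (weilField 1) ↔ Even β := by
  rw [mul_mem_normUnitsSubgroup_iff_of_mem _ _ (pow_mem_normUnitsSubgroup _ mem_2 α)]
  exact pow_mem_normUnitsSubgroup_iff_even _ Summit.HodgeConjecture.Ring2WeilNormDescent.three_not_mem_norm_one β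

end SqrtNeg1

namespace SqrtNeg2

/-- `K = ℚ(√-2)`: **`2^α · 3^β ∈ Nm(ℚ(√-2)ˣ)` always** (`2 = 0² + 2·1²`, `3 = 1² + 2·1²`): every `ℤ/m`-Prym piece
with `8 ∣ m ∣ 72` and order-free lattice lies on the SPLIT `ℚ(√-2)`-row.
research route conditional on HC_CM; not a corollary; Q11.4-sentence-2 already refuted in dim ≥ 3. [cite: vanGeemen1994HodgeAV, (5.4.1)] -/
theorem two_pow_mul_three_pow_mem (α β : ℕ) :
    Units.mk0 ((2 : ℚ) ^ α * 3 ^ β) (mul_ne_zero (pow_ne_zero α two_ne_zero) (pow_ne_zero β three_ne_zero)) ∈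
        normUnitsSubgroup ℚ (weilField 2) := by
  rw [mul_mem_normUnitsSubgroup_iff_of_mem _ _ (pow_mem_normUnitsSubgroup _ mem_2 α)]
  exact pow_mem_normUnitsSubgroup _ mem_3 β

end SqrtNeg2

namespace SqrtNeg3

/-- `K = ℚ(√-3)`: **`2^α · 3^β ∈ Nm(ℚ(√-3)ˣ) ↔ α` even** (`3 = 0² + 3·1²` is a norm, `2 ∉ Nm(ℚ(√-3)ˣ)` — inert).
These are the possible values of `[Λ:Λ₀]·d₁⋯d_g` for a `ℤ/m`-Prym piece with `3 ∣ m ∣ 36`: such a piece lies on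
the split `ℚ(√-3)`-row iff `v₂(d₁⋯d_g)` is even and on the row `[(-1)ⁿ·2]` (`T = {2, 3}`; R1 at `n = 3`) iff odd
— the ring2-b06 b06.5 (B)(ii) / pub-hsemireg PARITY LEMMA dichotomy for every such `m`.
research route conditional on HC_CM; not a corollary; Q11.4-sentence-2 already refuted in dim ≥ 3. [cite: vanGeemen1994HodgeAV, (5.4.1)] -/
theorem two_pow_mul_three_pow_mem_iff (α β : ℕ) :
    Units.mk0 ((2 : ℚ) ^ α * 3 ^ β) (mul_ne_zero (pow_ne_zero α two_ne_zero) (pow_ne_zero β three_ne_zero)) ∈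
        normUnitsSubgroup ℚ (weilField 3) ↔ Even α := by
  have hcomm : Units.mk0 ((2 : ℚ) ^ α * 3 ^ β)
        (mul_ne_zero (pow_ne_zero α two_ne_zero) (pow_ne_zero β three_ne_zero)) =
      Units.mk0 ((3 : ℚ) ^ β * 2 ^ α)
        (mul_ne_zero (pow_ne_zero β three_ne_zero) (pow_ne_zero α two_ne_zero)) :=
    Units.ext (by rw [Units.val_mk0, Units.val_mk0, mul_comm])
  rw [hcomm, mul_mem_normUnitsSubgroup_iff_of_mem _ _ (pow_mem_normUnitsSubgroup _ mem_3 β)]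
  exact pow_mem_normUnitsSubgroup_iff_even _ Summit.HodgeConjecture.Ring2WeilNormDescent.two_not_mem_norm_three α

/-- `K = ℚ(√-3)`: **`3^α · 5^β ∈ Nm(ℚ(√-3)ˣ) ↔ β` even** (`5 ∉ Nm(ℚ(√-3)ˣ)` — inert, `T(5) = {3, 5}`). The
possible values of `[Λ:Λ₀]·d₁⋯d_g` for a `ℤ/15`- or `ℤ/45`-Prym piece: such a piece lies on the `ℚ(√-3)`-row
`[(-1)ⁿ·5]` (R2 at `n = 3`; W8.3.5 at `n = 4`) iff `v₅(d₁⋯d_g)` is odd.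
research route conditional on HC_CM; not a corollary; Q11.4-sentence-2 already refuted in dim ≥ 3. [cite: vanGeemen1994HodgeAV, (5.4.1)] -/
theorem three_pow_mul_five_pow_mem_iff (α β : ℕ) :
    Units.mk0 ((3 : ℚ) ^ α * 5 ^ β) (mul_ne_zero (pow_ne_zero α three_ne_zero) (pow_ne_zero β (by norm_num))) ∈
        normUnitsSubgroup ℚ (weilField 3) ↔ Even β := by
  rw [mul_mem_normUnitsSubgroup_iff_of_mem _ _ (pow_mem_normUnitsSubgroup _ mem_3 α)]
  exact pow_mem_normUnitsSubgroup_iff_even _ Summit.HodgeConjecture.Ring2WeilNormDescent.five_not_mem_norm_three β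

end SqrtNeg3

/-! ### §5 Census sentences: order-free special fibres of type `2^α 3^β` / `3^α 5^β` -/

section Census

variable {ι : Type*} {E : Type*} [NormedAddCommGroup E] [NormedSpace ℂ E]
  {Φ : (ι → ℝ) ≃L[ℝ] E} {ω : E [⋀^Fin 2]→L[ℝ] ℝ} {g : ℕ} {dtyp : Fin g → ℕ}
  {n : ℕ} {q : ℚ}

/-- **`K = ℚ(i)`, type `2^α 3^β`, order-free lattice: SPLIT iff `β` even** (R3-type row `[(-1)ⁿ·3]` iff odd) —
e.g. every `ℤ/12`-Prym piece of `ℚ(i)`-Weil type; at `n = 3` the datum `(q; α) = (1; 2,3,7)` has type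
`(1,2,2,6,6,6)`, `β = 3`: row R3 (kit j170741 / `WEIL-FAMILY-COVERAGE.md` b04.7).
research route conditional on HC_CM; not a corollary; Q11.4-sentence-2 already refuted in dim ≥ 3. [cite: vanGeemen1994HodgeAV, (5.4.1)] -/
theorem sqrtNeg1_mk_det_eq_split_iff_even_of_type_two_three
    {a b : Matrix (Fin (2 * n)) (Fin (2 * n)) ℚ} (hd : IsPolarizationType Φ ω dtyp)
    (e : Fin (4 * n) ≃ ι) (P : Matrix (Fin (4 * n)) (Fin (4 * n)) ℤ)
    (hF : (Matrix.of fun j j' =>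
        ω ![Φ (intVec fun i => P (e.symm i) j), Φ (intVec fun i => P (e.symm i) j')]) =
      (weilStdGramMatrix n 1 a b).map (Rat.cast : ℚ → ℝ))
    (ha : a.IsSymm) (hb : bᵀ = -b) (hq : (weilGramMatrix 1 a b).det = algebraMap ℚ (weilField 1) q)
    (hsign : 0 < (-1 : ℚ) ^ n * q) (hq0 : q ≠ 0) {w : ℕ} (hidx : P.det.natAbs = w ^ 2)
    {α β : ℕ} (htyp : (∏ i, (dtyp i : ℚ)) = 2 ^ α * 3 ^ β) :
    (QuotientGroup.mk (Units.mk0 q hq0) : weilNormResidueGroup 1) = splitDiscriminantClass n 1 ↔ Even β := by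
  have hprod : (∏ i, (dtyp i : ℚ)) ≠ 0 := by
    rw [htyp]
    exact mul_ne_zero (pow_ne_zero α two_ne_zero) (pow_ne_zero β three_ne_zero)
  rw [mk_det_eq_splitDiscriminantClass_iff_prod_type_mem_of_index_sq hd one_pos e P hF ha hb hq hsign hq0
    hidx hprod]
  have hu : Units.mk0 (∏ i, (dtyp i : ℚ)) hprod = Units.mk0 ((2 : ℚ) ^ α * 3 ^ β)
      (mul_ne_zero (pow_ne_zero α two_ne_zero) (pow_ne_zero β three_ne_zero)) := Units.ext htyp
  rw [hu, SqrtNeg1.two_pow_mul_three_pow_mem_iff]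

/-- **`K = ℚ(√-3)`, type `2^α 3^β`, order-free lattice: SPLIT iff `α` even** (R1-type row `[(-1)ⁿ·2]` iff odd) —
every `ℤ/6`-, `ℤ/12`-, `ℤ/18`-, `ℤ/36`-Prym piece of `ℚ(√-3)`-Weil type.
research route conditional on HC_CM; not a corollary; Q11.4-sentence-2 already refuted in dim ≥ 3. [cite: vanGeemen1994HodgeAV, (5.4.1)] -/
theorem sqrtNeg3_mk_det_eq_split_iff_even_of_type_two_three
    {a b : Matrix (Fin (2 * n)) (Fin (2 * n)) ℚ} (hd : IsPolarizationType Φ ω dtyp)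
    (e : Fin (4 * n) ≃ ι) (P : Matrix (Fin (4 * n)) (Fin (4 * n)) ℤ)
    (hF : (Matrix.of fun j j' =>
        ω ![Φ (intVec fun i => P (e.symm i) j), Φ (intVec fun i => P (e.symm i) j')]) =
      (weilStdGramMatrix n 3 a b).map (Rat.cast : ℚ → ℝ))
    (ha : a.IsSymm) (hb : bᵀ = -b) (hq : (weilGramMatrix 3 a b).det = algebraMap ℚ (weilField 3) q)
    (hsign : 0 < (-1 : ℚ) ^ n * q) (hq0 : q ≠ 0) {w : ℕ} (hidx : P.det.natAbs = w ^ 2)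
    {α β : ℕ} (htyp : (∏ i, (dtyp i : ℚ)) = 2 ^ α * 3 ^ β) :
    (QuotientGroup.mk (Units.mk0 q hq0) : weilNormResidueGroup 3) = splitDiscriminantClass n 3 ↔ Even α := by
  have hprod : (∏ i, (dtyp i : ℚ)) ≠ 0 := by
    rw [htyp]
    exact mul_ne_zero (pow_ne_zero α two_ne_zero) (pow_ne_zero β three_ne_zero)
  rw [mk_det_eq_splitDiscriminantClass_iff_prod_type_mem_of_index_sq hd (by norm_num) e P hF ha hb hq hsign
    hq0 hidx hprod]
  have hu : Units.mk0 (∏ i, (dtyp i : ℚ)) hprod = Units.mk0 ((2 : ℚ) ^ α * 3 ^ β)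
      (mul_ne_zero (pow_ne_zero α two_ne_zero) (pow_ne_zero β three_ne_zero)) := Units.ext htyp
  rw [hu, SqrtNeg3.two_pow_mul_three_pow_mem_iff]

/-- **`K = ℚ(√-3)`, type `3^α 5^β`, order-free lattice: SPLIT iff `β` even** (row `[(-1)ⁿ·5]`, `T = {3,5}`, iff odd)
— every `ℤ/15`-, `ℤ/45`-Prym piece of `ℚ(√-3)`-Weil type; e.g. the `ℤ/15`-eightfolds `(0; 1,1,3,10)`, type
`∏dᵢ = 45`, on W8.3.5 (kit j170741 / b04.7).
research route conditional on HC_CM; not a corollary; Q11.4-sentence-2 already refuted in dim ≥ 3. [cite: vanGeemen1994HodgeAV, (5.4.1)] -/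
theorem sqrtNeg3_mk_det_eq_split_iff_even_of_type_three_five
    {a b : Matrix (Fin (2 * n)) (Fin (2 * n)) ℚ} (hd : IsPolarizationType Φ ω dtyp)
    (e : Fin (4 * n) ≃ ι) (P : Matrix (Fin (4 * n)) (Fin (4 * n)) ℤ)
    (hF : (Matrix.of fun j j' =>
        ω ![Φ (intVec fun i => P (e.symm i) j), Φ (intVec fun i => P (e.symm i) j')]) =
      (weilStdGramMatrix n 3 a b).map (Rat.cast : ℚ → ℝ))
    (ha : a.IsSymm) (hb : bᵀ = -b) (hq : (weilGramMatrix 3 a b).det = algebraMap ℚ (weilField 3) q)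
    (hsign : 0 < (-1 : ℚ) ^ n * q) (hq0 : q ≠ 0) {w : ℕ} (hidx : P.det.natAbs = w ^ 2)
    {α β : ℕ} (htyp : (∏ i, (dtyp i : ℚ)) = 3 ^ α * 5 ^ β) :
    (QuotientGroup.mk (Units.mk0 q hq0) : weilNormResidueGroup 3) = splitDiscriminantClass n 3 ↔ Even β := by
  have hprod : (∏ i, (dtyp i : ℚ)) ≠ 0 := by
    rw [htyp]
    exact mul_ne_zero (pow_ne_zero α three_ne_zero) (pow_ne_zero β (by norm_num))
  rw [mk_det_eq_splitDiscriminantClass_iff_prod_type_mem_of_index_sq hd (by norm_num) e P hF ha hb hq hsign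
    hq0 hidx hprod]
  have hu : Units.mk0 (∏ i, (dtyp i : ℚ)) hprod = Units.mk0 ((3 : ℚ) ^ α * 5 ^ β)
      (mul_ne_zero (pow_ne_zero α three_ne_zero) (pow_ne_zero β (by norm_num))) := Units.ext htyp
  rw [hu, SqrtNeg3.three_pow_mul_five_pow_mem_iff]

end Census

end Summit.HodgeConjecture.HodgeConjecture.Ring2.WeilCoverage
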